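import Literature.NumberTheory.Automorphic.RankinSelbergTorusIntegral
import Literature.NumberTheory.Automorphic.AutomorphicRepsGLCuspidalL2Step1ZFinite
import Literature.NumberTheory.Automorphic.AutomorphicRepsGLCuspidalL2Step4
import Literature.NumberTheory.Automorphic.AutomorphicFormsGLContinuous
import Literature.NumberTheory.Automorphic.GLnCentralCharacter
import Literature.NumberTheory.Automorphic.CuspFormsRapidDecayLevel
import HarnessLib

/-!
# Honest cusp forms in a cuspidal `L²` representation: pointwise Hecke equations and the unramified
Whittaker–Hecke datum at every good place

Topic `NumberTheory/Automorphic`; namespace `Literature.NumberTheory.Automorphic`. Proof file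
(theorems only). `WhittakerCoeffCuspidal` / `RankinSelbergTorusIntegral` prove, for the SMOOTHED vectors
`S_η f` of a cuspidal automorphic representation `Π ⊆ L²(GL_n(K) A_G \ GL_n(𝔸_K))` with Satake family
`α` off `S`, that the global Whittaker coefficient `W_φ`, `φ = invQuot (S_η f)`, is an unramified
Whittaker–Hecke datum at every good place (`exists_isTorusUnramifiedAt_whittakerCoeff_smoothedForm`: the
input of the Euler factorisation of the unfolded Rankin–Selberg integrals, Cogdell (2004), Thm. 3.3 /
Jacquet–Shalika (1981), §2). The `GL_{m+1} × GL_m` programme (`JPSSGlobalIntegral`,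
`JPSSUnfoldedAbsoluteConvergence`) is written for HONEST cusp forms (`IsCuspFormGL`: smooth,
`K_∞`-finite, `Z(𝔤)`-finite, of moderate growth, cuspidal), for which the Fourier–Whittaker expansion and
the gauge estimates are available. This file supplies such forms inside `Π` with the same Hecke data:

* `sum_inv_smul_eq_of_ae_eq` — **Hecke operators act pointwise on continuous representatives**: if a
  `Kf`-fixed vector `sv ∈ W` (`W` a closed subrepresentation of `L²`) is represented by a continuous
  function `Φ` on the automorphic quotient and `[Kf t Kf] sv = c sv`, then
  `∑_{y ∈ s} Φ(y⁻¹ x) = c Φ(x)` at every point (a.e. by `heckeOperator_apply_eq_sum`, everywhere by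
  continuity and positivity of the automorphic measure on open sets) — the proof of
  `sum_smoothedForm_inv_smul_eq` verbatim for a general continuous representative;
* `sum_invQuot_mul_ofLocal_rep_eq_of_ae_eq` — **the pointwise Hecke equations at a good place** for
  `φ = invQuot Φ`, `Φ` a continuous representative of a `K(𝔫₀)`-fixed vector of `Π`:
  `∑_{(S,ā)} φ(y ι_v(u_a ϖ^{ε_S})) = q_v^{r(n-r)/2} e_r(x) φ(y)` (as `sum_invQuot_smoothedForm_mul_ofLocal_rep_eq`);
* `exists_isTorusUnramifiedAt_whittakerCoeff_of_ae_eq` — hence **`W_φ` is an unramified Whittaker–Hecke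
  datum at `v`** (`IsTorusUnramifiedAt`; as `exists_isTorusUnramifiedAt_whittakerCoeff_smoothedForm`);
* `exists_isCuspFormGL_invQuot_mem` — **`Π` contains a non-zero honest cusp form**: a function `Φ` on
  the quotient, continuous, with `[Φ] ∈ Π`, `invQuot Φ ≠ 0` an honest cusp form
  (`AutomorphicRepsGL.formsOfL2_ne_bot_holds`, `AutomorphicRepsGL.isCuspFormGL_invQuot_of_mem_cuspidalSubspace_holds`);
* `exists_isCuspFormGL_isTorusUnramifiedAt_whittakerCoeff` (**main**) — for cuspidal `Π` with Satake
  family `α` off `S` there are a non-zero honest cusp form `φ = invQuot Φ` with `[Φ] ∈ Π`, a level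
  `𝔫₀ ≠ 0` with `φ` right `K(𝔫₀)`-invariant, and a unitary Hecke character `ω` with
  `φ((z 1_n) g) = ω(z) φ(g)`, such that at every `v ∉ S`, `v ∤ 𝔫₀` where `ψ_v` has conductor `𝒪_v`, for
  every enumeration `x` of `α_v`, `W_φ = whittakerCoeff ν 𝓕 ψ φ` is an unramified Whittaker–Hecke datum
  with parameters `x` for some uniformizer (Borel–Jacquet (1979), §4.6: the `K`-finite vectors of an
  irreducible `Π ⊆ L²_cusp` are cusp forms on which the unramified Hecke algebra acts by the Satake
  parameters; Shintani (1976) for the Whittaker function).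

## References

* A. Borel, H. Jacquet, *Automorphic forms and automorphic representations*, Corvallis (1979),
  §4.4–4.6 [BorelJacquet1979].
* T. Shintani, *On an explicit formula for class-1 Whittaker functions on `GL_n` over `P`-adic fields*,
  Proc. Japan Acad. 52 (1976) [Shintani1976].
* J. W. Cogdell, *Analytic theory of L-functions for GL_n* (2004), §1.1, §3 Thm. 3.3 [CogdellAnalyticTheory2004].
-/

noncomputable section

open scoped MatrixGroups ComplexConjugate
open NumberField IsDedekindDomain MeasureTheory Measure Matrix ValuativeRel Filter Topology
open Literature.RingTheory.SymmetricFunctions.SymmPoly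

namespace Literature.NumberTheory.Automorphic

/-! ### Hecke operators act pointwise on continuous representatives -/

section Pointwise

variable {n : ℕ} {K : Type} [Field K] [NumberField K]
  {μ : Measure (AdelicGroupData.gl n K).automorphicQuotient}
  [(AdelicGroupData.gl n K).IsAutomorphicMeasure μ]

attribute [local instance] adelicBorel borelSpace_adelic locallyCompactSpace_adelic
  secondCountableTopology_gl_adelic

variable (W : ContRepresentation.ClosedSubrep ((AdelicGroupData.gl n K).rightRegular μ))

/-- **Hecke operators act pointwise on continuous representatives.** If the `Kf`-fixed vector
`sv ∈ W` is represented by the continuous function `Φ` on the automorphic quotient and is an eigenvector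
of the double-coset operator `[Kf t Kf]` with eigenvalue `c`, then for every transversal `s` of
`Kf t Kf / Kf`, `Σ_{y ∈ s} Φ (y⁻¹ • x) = c Φ (x)` at **every** point `x` (a.e. by
`heckeOperator_apply_eq_sum` and `rightRegular_apply_coeFn`, then everywhere by continuity and positivity
of `μ` on open sets). [folklore] -/
theorem sum_inv_smul_eq_of_ae_eq {Φ : (AdelicGroupData.gl n K).automorphicQuotient → ℂ} (hΦc : Continuous Φ)
    (sv : W.toSubmodule)
    (hae : ((sv : (AdelicGroupData.gl n K).L2 μ) : (AdelicGroupData.gl n K).automorphicQuotient → ℂ) =ᵐ[μ] Φ)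
    {Kf : Subgroup (AdelicGroupData.gl n K).Adelic}
    (t : (AdelicGroupData.gl n K).Adelic) (s : Finset (AdelicGroupData.gl n K).Adelic)
    (hs : Set.BijOn (fun x : (AdelicGroupData.gl n K).Adelic =>
      (x : (AdelicGroupData.gl n K).Adelic ⧸ Kf)) s (MulAction.orbit Kf (t : _ ⧸ Kf)))
    (hsv : sv ∈ W.fixedVectors Kf) {c : ℂ}
    (heig : heckeOperatorAt W Kf t sv = c • sv)
    (x : (AdelicGroupData.gl n K).automorphicQuotient) :
    ∑ y ∈ s, Φ (y⁻¹ • x) = c * Φ x := by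
  -- the operator identity in `W`, then in `L²`
  have hop : heckeOperatorAt W Kf t sv = ∑ y ∈ s, W.toContRep y sv :=
    heckeOperator_apply_eq_sum W.toContRep.toRepresentation Kf t s hs hsv
  have hL2 : ((c • sv : W.toSubmodule) : (AdelicGroupData.gl n K).L2 μ) =
      ∑ y ∈ s, (AdelicGroupData.gl n K).rightRegular μ y (sv : (AdelicGroupData.gl n K).L2 μ) := by
    rw [← heig, hop, Submodule.coe_sum]
    rfl
  -- a.e. pointwise versions of both sides
  have hright : ∀ s' : Finset (AdelicGroupData.gl n K).Adelic,
      ((∑ y ∈ s', (AdelicGroupData.gl n K).rightRegular μ y (sv : (AdelicGroupData.gl n K).L2 μ) :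
        (AdelicGroupData.gl n K).L2 μ) : (AdelicGroupData.gl n K).automorphicQuotient → ℂ) =ᵐ[μ]
        fun x => ∑ y ∈ s', Φ (y⁻¹ • x) := by
    classical
    intro s'
    induction s' using Finset.induction_on with
    | empty =>
      simp only [Finset.sum_empty]
      exact Lp.coeFn_zero _ _ _
    | insert y s' hy ih =>
      rw [Finset.sum_insert hy]
      filter_upwards [Lp.coeFn_add ((AdelicGroupData.gl n K).rightRegular μ y
          (sv : (AdelicGroupData.gl n K).L2 μ)) (∑ y ∈ s', (AdelicGroupData.gl n K).rightRegular μ y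
          (sv : (AdelicGroupData.gl n K).L2 μ)), ih,
        AdelicGroupData.rightRegular_apply_coeFn (AdelicGroupData.gl n K) μ y
          (sv : (AdelicGroupData.gl n K).L2 μ), ae_eq_comp_smul hae y⁻¹] with z h1 h2 h3 h4
      rw [h1, Pi.add_apply, h2, h3, h4, Finset.sum_insert hy]
  have hleft : (((c • sv : W.toSubmodule) : (AdelicGroupData.gl n K).L2 μ) :
      (AdelicGroupData.gl n K).automorphicQuotient → ℂ) =ᵐ[μ] fun x => c * Φ x := by
    rw [Submodule.coe_smul]
    filter_upwards [Lp.coeFn_smul c (sv : (AdelicGroupData.gl n K).L2 μ), hae] with z h1 h2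
    rw [h1, Pi.smul_apply, h2, smul_eq_mul]
  have hae' : (fun x => ∑ y ∈ s, Φ (y⁻¹ • x)) =ᵐ[μ] fun x => c * Φ x := by
    rw [hL2] at hleft
    exact (hright s).symm.trans hleft
  -- continuity upgrades a.e. to everywhere
  have hc1 : Continuous fun x => ∑ y ∈ s, Φ (y⁻¹ • x) :=
    continuous_finsetSum _ fun y _ => hΦc.comp (continuous_const_smul y⁻¹)
  have hc2 : Continuous fun x => c * Φ x := continuous_const.mul hΦc
  exact congrFun ((hc1.ae_eq_iff_eq μ hc2).1 hae') x

/-- **Scalar intertwiners act pointwise on continuous representatives**: if `R(y) sv = c sv` in `L²`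
and `sv` is represented by the continuous `Φ`, then `Φ (y⁻¹ • x) = c Φ x` everywhere. [folklore] -/
theorem apply_inv_smul_eq_of_ae_eq {Φ : (AdelicGroupData.gl n K).automorphicQuotient → ℂ} (hΦc : Continuous Φ)
    (sv : (AdelicGroupData.gl n K).L2 μ)
    (hae : (sv : (AdelicGroupData.gl n K).automorphicQuotient → ℂ) =ᵐ[μ] Φ)
    (y : (AdelicGroupData.gl n K).Adelic) {c : ℂ}
    (heig : (AdelicGroupData.gl n K).rightRegular μ y sv = c • sv)
    (x : (AdelicGroupData.gl n K).automorphicQuotient) :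
    Φ (y⁻¹ • x) = c * Φ x := by
  have h1 : (((AdelicGroupData.gl n K).rightRegular μ y sv : (AdelicGroupData.gl n K).L2 μ) :
      (AdelicGroupData.gl n K).automorphicQuotient → ℂ) =ᵐ[μ] fun x => Φ (y⁻¹ • x) := by
    filter_upwards [AdelicGroupData.rightRegular_apply_coeFn (AdelicGroupData.gl n K) μ y sv,
      ae_eq_comp_smul hae y⁻¹] with z h1 h2
    rw [h1, h2]
  have h2 : (((AdelicGroupData.gl n K).rightRegular μ y sv : (AdelicGroupData.gl n K).L2 μ) :
      (AdelicGroupData.gl n K).automorphicQuotient → ℂ) =ᵐ[μ] fun x => c * Φ x := by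
    rw [heig]
    filter_upwards [Lp.coeFn_smul c sv, hae] with z h1 h2
    rw [h1, Pi.smul_apply, h2, smul_eq_mul]
  have hc1 : Continuous fun x => Φ (y⁻¹ • x) := hΦc.comp (continuous_const_smul y⁻¹)
  have hc2 : Continuous fun x => c * Φ x := continuous_const.mul hΦc
  exact congrFun ((hc1.ae_eq_iff_eq μ hc2).1 (h1.symm.trans h2)) x

/-- **A continuous representative of a right-`Kf`-invariant class is a `Kf`-fixed vector.** If
`invQuot Φ` is right `Kf`-invariant and `[Φ] = sv ∈ W`, then `sv ∈ W^{Kf}`. [folklore] -/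
theorem mem_fixedVectors_of_ae_eq {Φ : (AdelicGroupData.gl n K).automorphicQuotient → ℂ}
    (sv : W.toSubmodule)
    (hae : ((sv : (AdelicGroupData.gl n K).L2 μ) : (AdelicGroupData.gl n K).automorphicQuotient → ℂ) =ᵐ[μ] Φ)
    {Kf : Subgroup (AdelicGroupData.gl n K).Adelic}
    (hΦK : ∀ k ∈ Kf, ∀ y : (AdelicGroupData.gl n K).Adelic,
      invQuot (AdelicGroupData.gl n K) Φ (y * k) = invQuot (AdelicGroupData.gl n K) Φ y) :
    sv ∈ W.fixedVectors Kf := by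
  rw [ContRepresentation.ClosedSubrep.mem_fixedVectors]
  intro k hk
  -- pointwise: `Φ (k⁻¹ • x) = Φ x`
  have hpt : ∀ x : (AdelicGroupData.gl n K).automorphicQuotient, Φ (k⁻¹ • x) = Φ x := by
    intro x
    induction x using QuotientGroup.induction_on with
    | H g =>
      have h1 := invQuot_mul_eq_smul Φ g⁻¹ k
      rw [inv_inv] at h1
      have h2 : invQuot (AdelicGroupData.gl n K) Φ (g⁻¹ * k) = invQuot (AdelicGroupData.gl n K) Φ g⁻¹ := hΦK k hk g⁻¹
      rw [h1, invQuot_apply, inv_inv] at h2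
      exact h2
  refine Subtype.ext (Lp.ext ?_)
  change (((AdelicGroupData.gl n K).rightRegular μ k (sv : (AdelicGroupData.gl n K).L2 μ) :
      (AdelicGroupData.gl n K).L2 μ) : (AdelicGroupData.gl n K).automorphicQuotient → ℂ) =ᵐ[μ]
    ((sv : (AdelicGroupData.gl n K).L2 μ) : (AdelicGroupData.gl n K).automorphicQuotient → ℂ)
  filter_upwards [AdelicGroupData.rightRegular_apply_coeFn (AdelicGroupData.gl n K) μ k
      (sv : (AdelicGroupData.gl n K).L2 μ), ae_eq_comp_smul hae k⁻¹, hae] with z h1 h2 h3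
  rw [h1, h2, hpt z, h3]

end Pointwise

/-! ### The pointwise Hecke equations and the unramified datum of a continuous representative -/

section Cuspidal

variable {n : ℕ} {K : Type} [Field K] [NumberField K]
  {μ : Measure (AdelicGroupData.gl n K).automorphicQuotient}
  [(AdelicGroupData.gl n K).IsAutomorphicMeasure μ]

attribute [local instance] adelicBorel borelSpace_adelic locallyCompactSpace_adelic
  secondCountableTopology_gl_adelic

omit [(AdelicGroupData.gl n K).IsAutomorphicMeasure μ] in
/-- **Right `ι_v(GL_n(𝒪_v))`-invariance from the level**: a right `K(𝔫₀)`-invariant function is right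
invariant under `ι_v(GL_n(𝒪_v))` for `v ∤ 𝔫₀ ≠ 0` (`K(𝔫₀) ⊇ ι_v(GL_n(𝒪_v))`). [folklore] -/
theorem apply_mul_ofLocal_of_rightInvariant {𝔫₀ : Ideal (𝓞 K)} (h𝔫₀ : 𝔫₀ ≠ 0)
    {v : HeightOneSpectrum (𝓞 K)} (hv : ¬ v.asIdeal ∣ 𝔫₀) {φ : GL (Fin n) (AdeleRing (𝓞 K) K) → ℂ}
    (hφU : ∀ k ∈ principalCongruenceLevel n K 𝔫₀, ∀ y : GL (Fin n) (AdeleRing (𝓞 K) K), φ (y * k) = φ y)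
    {k : GL (Fin n) (v.adicCompletion K)} (hk : k ∈ glInt n (v.adicCompletion K))
    (y : GL (Fin n) (AdeleRing (𝓞 K) K)) :
    φ (y * GLn.ofLocal n K v k) = φ y :=
  hφU _ (map_ofLocal_glInt_le_principalCongruenceLevel n v h𝔫₀ hv ⟨k, hk, rfl⟩) y

/-- **The pointwise Hecke equations for a continuous representative at a good place.** Let `Π` be
cuspidal with Satake family `α` off `S`, `sv ∈ Π^{K(𝔫₀)}` (`𝔫₀ ≠ 0`) represented by the continuous
function `Φ` on the quotient, `v ∉ S` with `v ∤ 𝔫₀`, and `x` an enumeration of `α v`. Then for the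
uniformizer `ϖ` of the Satake datum at `v`, the left-invariant function `φ = invQuot Φ` satisfies, for
`1 ≤ r ≤ n` and every `y ∈ GL_n(𝔸_K)`, `∑_{(S,ā)} φ(y ι_v(u_a ϖ^{ε_S})) = q_v^{r(n-r)/2} e_r(x) φ(y)`
(`heckeOperatorAt_eq_satake_smul`, level change to `ι_v(GL_n(𝒪_v))`, the transported local transversal,
and `sum_inv_smul_eq_of_ae_eq`; the proof of `sum_invQuot_smoothedForm_mul_ofLocal_rep_eq` for a general
continuous representative). [folklore] -/
theorem sum_invQuot_mul_ofLocal_rep_eq_of_ae_eq (P : CuspidalAutomorphicRepGL n K μ)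
    {S : Set (HeightOneSpectrum (𝓞 K))} {α : SatakeFamily K} (hα : IsSatakeFamilyOf P S α)
    {𝔫₀ : Ideal (𝓞 K)} (h𝔫₀ : 𝔫₀ ≠ 0) {v : HeightOneSpectrum (𝓞 K)} (hvS : v ∉ S)
    (hv : ¬ v.asIdeal ∣ 𝔫₀) {Φ : (AdelicGroupData.gl n K).automorphicQuotient → ℂ} (hΦc : Continuous Φ)
    (sv : P.1.toSubmodule)
    (hae : ((sv : (AdelicGroupData.gl n K).L2 μ) : (AdelicGroupData.gl n K).automorphicQuotient → ℂ) =ᵐ[μ] Φ)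
    (hsvK : sv ∈ P.1.fixedVectors (principalCongruenceLevel n K 𝔫₀))
    {x : Fin n → ℂ} (hx : (Finset.univ : Finset (Fin n)).val.map x = α v) :
    ∃ (ϖ : (v.adicCompletion K)ˣ) (hϖ : Valued.v (ϖ : v.adicCompletion K) = WithZero.exp (-1 : ℤ)),
      ∀ r, 1 ≤ r → r ≤ n → ∀ y : GL (Fin n) (AdeleRing (𝓞 K) K),
        ∑ p : TransversalIndex n (v.adicCompletion K) r,
            invQuot (AdelicGroupData.gl n K) Φ
              (y * GLn.ofLocal n K v (p.rep (isUniformizingElement_of_valued_eq K v hϖ).ne_zero)) =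
          (((Real.sqrt (v.residueCard : ℝ) : ℝ) : ℂ)) ^ (r * (n - r)) * esymm x r *
            invQuot (AdelicGroupData.gl n K) Φ y := by
  classical
  obtain ⟨ϖ, hϖ, heig⟩ := heckeOperatorAt_eq_satake_smul P hα h𝔫₀ hvS hv hsvK
  refine ⟨ϖ, hϖ, fun r _ hrn y => ?_⟩
  have hϖ' : IsUniformizingElement (ϖ : v.adicCompletion K) :=
    isUniformizingElement_of_valued_eq K v hϖ
  -- the local spherical level `ι_v(GL_n(𝒪_v))` and the eigenvalue equation there
  have hle : (glInt n (v.adicCompletion K)).map (GLn.ofLocal n K v) ≤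
      principalCongruenceLevel n K 𝔫₀ :=
    map_ofLocal_glInt_le_principalCongruenceLevel n v h𝔫₀ hv
  have hsvKf : sv ∈ P.1.fixedVectors ((glInt n (v.adicCompletion K)).map (GLn.ofLocal n K v)) :=
    P.1.fixedVectors_antitone hle hsvK
  have ht : heckeDiagAt n K v ϖ r = GLn.ofLocal n K v (heckeDiag n ϖ r) := by
    rw [heckeDiagAt_eq_ofLocal_glDiagonal, glDiagonal_eq_heckeDiag]
  set c : ℂ := (((Real.sqrt (v.residueCard : ℝ) : ℝ) : ℂ)) ^ (r * (n - r)) * (α v).esymm r with hc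
  have heigKf : heckeOperatorAt P.1 ((glInt n (v.adicCompletion K)).map (GLn.ofLocal n K v))
      (GLn.ofLocal n K v (heckeDiag n ϖ r)) sv = c • sv :=
    (heckeOperatorAt_ofLocal_apply_eq_of_le P.1 hle (isMaximalAt_map_ofLocal_glInt n v)
      (principalCongruenceLevel_le n K 𝔫₀) _ hsvK).trans (by rw [← ht]; exact heig r hrn)
  -- the local transversal and its image under `ι_v`
  have hbij := bijOn_heckeTransversal (n := n) hϖ' hrn
  rw [Units.mk0_val] at hbij
  have hs := bijOn_image_map (GLn.ofLocal n K v) GLn.ofLocal_injective (glInt n (v.adicCompletion K))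
    (heckeDiag n ϖ r) (heckeTransversal (n := n) hϖ'.ne_zero r) hbij
  -- the point `[y⁻¹]` and the pointwise Hecke equation of the continuous representative
  set yA : (AdelicGroupData.gl n K).Adelic := y with hyA
  set X : (AdelicGroupData.gl n K).automorphicQuotient :=
    (AdelicGroupData.gl n K).toAutomorphicQuotient yA⁻¹ with hX
  set F : (AdelicGroupData.gl n K).Adelic → ℂ := fun z => Φ (z⁻¹ • X) with hF
  have hpt : ∑ z ∈ (heckeTransversal (n := n) hϖ'.ne_zero r).image (GLn.ofLocal n K v), F z = c * Φ X :=
    sum_inv_smul_eq_of_ae_eq P.1 hΦc sv hae (GLn.ofLocal n K v (heckeDiag n ϖ r)) _ hs hsvKf heigKf X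
  have e1 : ∑ z ∈ (heckeTransversal (n := n) hϖ'.ne_zero r).image (GLn.ofLocal n K v), F z =
      ∑ w ∈ heckeTransversal (n := n) hϖ'.ne_zero r, F (GLn.ofLocal n K v w) :=
    Finset.sum_image fun a _ b _ hab => GLn.ofLocal_injective hab
  have e2 : ∑ p : TransversalIndex n (v.adicCompletion K) r, F (GLn.ofLocal n K v (p.rep hϖ'.ne_zero)) =
      c * Φ X :=
    ((sum_heckeTransversal hϖ' r fun w => F (GLn.ofLocal n K v w)).symm.trans e1.symm).trans hpt
  -- assemble
  calc ∑ p : TransversalIndex n (v.adicCompletion K) r,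
        invQuot (AdelicGroupData.gl n K) Φ (y * GLn.ofLocal n K v (p.rep hϖ'.ne_zero))
        = ∑ p : TransversalIndex n (v.adicCompletion K) r, F (GLn.ofLocal n K v (p.rep hϖ'.ne_zero)) :=
        Finset.sum_congr rfl fun p _ => invQuot_mul_eq_smul _ yA _
    _ = c * Φ X := e2
    _ = (((Real.sqrt (v.residueCard : ℝ) : ℝ) : ℂ)) ^ (r * (n - r)) * esymm x r *
          invQuot (AdelicGroupData.gl n K) Φ y := by
        rw [hc, ← hx, ← esymm_eq_multiset_esymm, invQuot_apply]

variable [MeasurableSpace ↥(adelicUnipotent n K)] [BorelSpace ↥(adelicUnipotent n K)]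
  [MeasurableConstSMul ↥(rationalUnipotent n K) ↥(adelicUnipotent n K)]
  {ν : Measure ↥(adelicUnipotent n K)} [IsFiniteMeasureOnCompacts ν]
  [SMulInvariantMeasure ↥(rationalUnipotent n K) ↥(adelicUnipotent n K) ν] [ν.IsMulRightInvariant]
  {𝓕 : Set ↥(adelicUnipotent n K)} {ψ : AddChar (AdeleRing (𝓞 K) K) Circle}

/-- **The global Whittaker coefficient of a continuous representative of a `K(𝔫₀)`-fixed cuspidal
vector is an unramified torus datum at every good place.** Let `Π` be cuspidal with Satake family `α`
off `S`, `sv ∈ Π^{K(𝔫₀)}` (`𝔫₀ ≠ 0`) represented by the continuous `Φ` with `φ = invQuot Φ` right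
`K(𝔫₀)`-invariant, `ψ` a global additive character, `𝓕` a relatively compact fundamental domain of
`N_n(K)` in `N_n(𝔸_K)`; let `v ∉ S`, `v ∤ 𝔫₀`, with `ψ_v` of conductor `𝒪_v`, and `x` an enumeration of
`α v`. Then for the uniformizer `ϖ` of the Satake datum, `W_φ = whittakerCoeff ν 𝓕 ψ φ` is an unramified
Whittaker–Hecke datum at `v` (`IsTorusUnramifiedAt`): sphericity from the level, Shintani's formula and the
vanishing off the antitone cone by `whittakerCoeff_ofLocal_piPowGL_eq` / `…_eq_zero` fed with the
pointwise Hecke equations `sum_invQuot_mul_ofLocal_rep_eq_of_ae_eq` and `#𝓀_v = q_v`.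
[cite: Shintani1976, Theorem (p. 181)] -/
theorem exists_isTorusUnramifiedAt_whittakerCoeff_of_ae_eq (P : CuspidalAutomorphicRepGL n K μ)
    {S : Set (HeightOneSpectrum (𝓞 K))} {α : SatakeFamily K} (hα : IsSatakeFamilyOf P S α)
    {𝔫₀ : Ideal (𝓞 K)} (h𝔫₀ : 𝔫₀ ≠ 0) {v : HeightOneSpectrum (𝓞 K)} (hvS : v ∉ S)
    (hv : ¬ v.asIdeal ∣ 𝔫₀) {Φ : (AdelicGroupData.gl n K).automorphicQuotient → ℂ} (hΦc : Continuous Φ)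
    (sv : P.1.toSubmodule)
    (hae : ((sv : (AdelicGroupData.gl n K).L2 μ) : (AdelicGroupData.gl n K).automorphicQuotient → ℂ) =ᵐ[μ] Φ)
    (hΦU : ∀ k ∈ principalCongruenceLevel n K 𝔫₀, ∀ y : GL (Fin n) (AdeleRing (𝓞 K) K),
      invQuot (AdelicGroupData.gl n K) Φ (y * k) = invQuot (AdelicGroupData.gl n K) Φ y)
    {x : Fin n → ℂ} (hx : (Finset.univ : Finset (Fin n)).val.map x = α v)
    (h𝓕 : IsFundamentalDomain ↥(rationalUnipotent n K) 𝓕 ν) (h𝓕c : IsCompact (closure 𝓕))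
    (hψ : IsGlobalAddChar K ψ) (hψv : ∀ c ∈ 𝒪[v.adicCompletion K], ψ.adicComponent v c = 1)
    (hψv' : ∀ ϖ : v.adicCompletion K, Valued.v ϖ = WithZero.exp (-1 : ℤ) →
      ∃ c ∈ 𝒪[v.adicCompletion K], ψ.adicComponent v (ϖ⁻¹ * c) ≠ 1) :
    ∃ ϖ : (v.adicCompletion K)ˣ, IsTorusUnramifiedAt n K
      (whittakerCoeff ν 𝓕 ψ (invQuot (AdelicGroupData.gl n K) Φ)) v ϖ x := by
  have hsvK : sv ∈ P.1.fixedVectors (principalCongruenceLevel n K 𝔫₀) :=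
    mem_fixedVectors_of_ae_eq P.1 sv hae hΦU
  obtain ⟨ϖ, hϖ, hT⟩ := sum_invQuot_mul_ofLocal_rep_eq_of_ae_eq P hα h𝔫₀ hvS hv hΦc sv hae hsvK hx
  set φ : GL (Fin n) (AdeleRing (𝓞 K) K) → ℂ := invQuot (AdelicGroupData.gl n K) Φ with hφ
  have hφK : ∀ k ∈ glInt n (v.adicCompletion K), ∀ y : GL (Fin n) (AdeleRing (𝓞 K) K),
      φ (y * GLn.ofLocal n K v k) = φ y :=
    fun k hk y => apply_mul_ofLocal_of_rightInvariant h𝔫₀ hv hΦU hk y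
  have hφc : Continuous φ := by
    have h1 : Continuous fun g : (AdelicGroupData.gl n K).Adelic =>
        Φ ((AdelicGroupData.gl n K).toAutomorphicQuotient g⁻¹) :=
      hΦc.comp (QuotientGroup.continuous_mk.comp continuous_inv)
    have h2 : φ = fun g : (AdelicGroupData.gl n K).Adelic =>
        Φ ((AdelicGroupData.gl n K).toAutomorphicQuotient g⁻¹) := by
      funext g; exact invQuot_apply _ _ _
    rw [h2]; exact h1
  have hint : ∀ g, IntegrableOn (fun u : ↥(adelicUnipotent n K) =>
      φ ((u : GL (Fin n) (AdeleRing (𝓞 K) K)) * g) * conj (whittakerCharFun ψ u)) 𝓕 ν := fun g =>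
    integrableOn_whittakerIntegrand_of_continuous h𝓕c hψ.continuous hφc g
  have hs : (((Real.sqrt (v.residueCard : ℝ) : ℝ) : ℂ)) ≠ 0 := by
    rw [Complex.ofReal_ne_zero, Real.sqrt_ne_zero']
    exact_mod_cast zero_lt_one.trans v.one_lt_residueCard
  have hq' : ((Nat.card 𝓀[v.adicCompletion K] : ℕ) : ℂ) =
      (((Real.sqrt (v.residueCard : ℝ) : ℝ) : ℂ)) ^ 2 := by
    rw [natCard_valuativeResidueField_adicCompletion_eq, ← Complex.ofReal_pow,
      Real.sq_sqrt (Nat.cast_nonneg _), Complex.ofReal_natCast]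
  obtain ⟨c, hc, hcne⟩ := hψv' ϖ hϖ
  refine ⟨ϖ, hϖ, fun k hk g => whittakerCoeff_mul_of_forall ν 𝓕 ψ (hφK k hk) g, fun g hg mu => ?_⟩
  by_cases hmu : Antitone mu
  · rw [schurTrunc, if_pos hmu]
    exact whittakerCoeff_ofLocal_piPowGL_eq h𝓕 hψ (isLeftInvariant_invQuot _ _) hφK
      (isUniformizingElement_of_valued_eq K v hϖ) hT hint hg hψv ⟨c, hc, hcne⟩ hs hq' hmu
  · rw [schurTrunc, if_neg hmu, mul_zero, zero_mul]
    exact whittakerCoeff_ofLocal_piPowGL_eq_zero h𝓕 hψ (isLeftInvariant_invQuot _ _) hφK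
      (isUniformizingElement_of_valued_eq K v hϖ) hT hint hg ⟨c, hc, hcne⟩ hmu

end Cuspidal

/-! ### Honest cusp forms inside a cuspidal `L²` representation -/

section Honest

variable {n : ℕ} {K : Type} [Field K] [NumberField K]
  {μ : Measure (AdelicGroupData.gl n K).automorphicQuotient}
  [(AdelicGroupData.gl n K).IsAutomorphicMeasure μ]

attribute [local instance] adelicBorel borelSpace_adelic locallyCompactSpace_adelic
  secondCountableTopology_gl_adelic

open scoped Classical in
/-- **A cuspidal `L²` representation contains a non-zero honest cusp form.** For an irreducible closed
invariant `Π ≤ L²_cusp(GL_n(K) A_G \ GL_n(𝔸_K))` there is a continuous `Φ ∈ ℒ²` on the quotient with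
`[Φ] ∈ Π` whose classical function `invQuot Φ = (g ↦ Φ [g⁻¹])` is a non-zero cusp form
(`AutomorphicRepsGL.formsOfL2_ne_bot_holds`: `V_Π ≠ 0`, so one of its generators is non-zero;
`AutomorphicRepsGL.isCuspFormGL_invQuot_of_mem_cuspidalSubspace_holds`: automorphic forms with class in
`L²_cusp` are cusp forms; Borel–Jacquet (1979), 4.4–4.6). [cite: BorelJacquet1979, 4.6] -/
theorem exists_isCuspFormGL_invQuot_mem (P : CuspidalAutomorphicRepGL n K μ) :
    ∃ (Φ : (AdelicGroupData.gl n K).automorphicQuotient → ℂ) (hΦ2 : MemLp Φ 2 μ),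
      hΦ2.toLp Φ ∈ P.1 ∧ Continuous Φ ∧ invQuot (AdelicGroupData.gl n K) Φ ≠ 0 ∧
        IsCuspFormGL n K (isCompact_glFiniteIntegralLevel_holds n K) (invQuot (AdelicGroupData.gl n K) Φ) := by
  have hne := AutomorphicRepsGL.formsOfL2_ne_bot_holds (isCompact_glFiniteIntegralLevel_holds n K) μ P
  -- a non-zero generator of `V_Π`
  obtain ⟨φ, hφmem, hφ0⟩ : ∃ φ ∈ {φ : (AdelicGroupData.gl n K).Adelic → ℂ |
      ∃ (f : (AdelicGroupData.gl n K).automorphicQuotient → ℂ) (hf : MemLp f 2 μ),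
        hf.toLp f ∈ P.1 ∧ φ = invQuot (AdelicGroupData.gl n K) f ∧
          IsAutomorphicForm (AutomorphyDatum.gl n K (isCompact_glFiniteIntegralLevel_holds n K)) φ}, φ ≠ 0 := by
    by_contra h
    push Not at h
    apply hne
    rw [formsOfL2, Submodule.span_eq_bot]
    exact h
  obtain ⟨f, hf, hfP, rfl, hφ⟩ := hφmem
  refine ⟨f, hf, hfP, continuous_of_isAutomorphicForm_invQuot hφ, hφ0, ?_⟩
  exact AutomorphicRepsGL.isCuspFormGL_invQuot_of_mem_cuspidalSubspace_holds
    (isCompact_glFiniteIntegralLevel_holds n K) μ f hf (P.2.1 hfP) hφ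

omit [(AdelicGroupData.gl n K).IsAutomorphicMeasure μ] in
open scoped Classical in
/-- **A principal congruence level of an honest cusp form**: `invQuot Φ` is right `K(𝔫₀)`-invariant for
some `𝔫₀ ≠ 0` (its level contains a principal congruence subgroup,
`exists_forall_conj_mem_of_mem_finiteLevelsGL`). [folklore] -/
theorem IsCuspFormGL.exists_principalCongruenceLevel {φ : (AdelicGroupData.gl n K).Adelic → ℂ}
    (hφ : IsCuspFormGL n K (isCompact_glFiniteIntegralLevel_holds n K) φ) :
    ∃ 𝔫₀ : Ideal (𝓞 K), 𝔫₀ ≠ 0 ∧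
      ∀ k ∈ principalCongruenceLevel n K 𝔫₀, ∀ y : GL (Fin n) (AdeleRing (𝓞 K) K), φ (y * k) = φ y := by
  obtain ⟨U, hU, hφU⟩ := hφ.1.exists_level
  rw [AutomorphyDatum.gl_finiteLevels] at hU
  obtain ⟨𝔫, h𝔫, h𝔫U⟩ := exists_forall_conj_mem_of_mem_finiteLevelsGL hU (Θ := {1}) isCompact_singleton
  refine ⟨𝔫, h𝔫, fun u hu y => ?_⟩
  have hmem := h𝔫U 1 (Set.mem_singleton 1) u hu
  rw [inv_one, one_mul, mul_one] at hmem
  exact hφU u hmem y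

/-- **The central character acts pointwise on honest forms of `Π`.** For the unitary central character
`ω = ω_Π` (`CuspidalAutomorphicRepGL.exists_centralCharacter`) and a continuous `Φ` with `[Φ] ∈ Π`:
`invQuot Φ ((z 1_n) g) = ω(z) invQuot Φ (g)` for all `z ∈ 𝔸_Kˣ`, `g`. [folklore] -/
theorem exists_centralCharacter_invQuot (P : CuspidalAutomorphicRepGL n K μ)
    {Φ : (AdelicGroupData.gl n K).automorphicQuotient → ℂ} (hΦc : Continuous Φ) (hΦ2 : MemLp Φ 2 μ)
    (hP : hΦ2.toLp Φ ∈ P.1) :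
    ∃ ω : Literature.NumberTheory.GaloisRepresentations.HeckeCharacter K, ω.IsUnitary ∧
      (∀ t : NNRealˣ, ω (posRealIdele K t) = 1) ∧
      ∀ (z : Literature.NumberTheory.GaloisRepresentations.ideleGroup K) (g : GL (Fin n) (AdeleRing (𝓞 K) K)),
        invQuot (AdelicGroupData.gl n K) Φ (Matrix.GeneralLinearGroup.scalar (Fin n) z * g) =
          ((ω z : ℂˣ) : ℂ) * invQuot (AdelicGroupData.gl n K) Φ g := by
  obtain ⟨ω, hu, hA, hact, -, -⟩ := P.exists_centralCharacter
  refine ⟨ω, hu, hA, fun z g => ?_⟩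
  set sv : P.1.toSubmodule := ⟨hΦ2.toLp Φ, ContRepresentation.ClosedSubrep.mem_toSubmodule.2 hP⟩ with hsv
  have hae : ((sv : (AdelicGroupData.gl n K).L2 μ) : (AdelicGroupData.gl n K).automorphicQuotient → ℂ) =ᵐ[μ] Φ :=
    hΦ2.coeFn_toLp
  have heig : (AdelicGroupData.gl n K).rightRegular μ (Matrix.GeneralLinearGroup.scalar (Fin n) z)
      (sv : (AdelicGroupData.gl n K).L2 μ) = ((ω z : ℂˣ) : ℂ) • (sv : (AdelicGroupData.gl n K).L2 μ) := by
    have h := congrArg (fun w : P.1.toSubmodule => (w : (AdelicGroupData.gl n K).L2 μ)) (hact z sv)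
    simp only [Submodule.coe_smul] at h
    exact h
  have hpt := apply_inv_smul_eq_of_ae_eq hΦc (sv : (AdelicGroupData.gl n K).L2 μ) hae
    (Matrix.GeneralLinearGroup.scalar (Fin n) z) heig
  set sc : (AdelicGroupData.gl n K).Adelic := Matrix.GeneralLinearGroup.scalar (Fin n) z with hsc
  set gA : (AdelicGroupData.gl n K).Adelic := g with hgA
  have key : ∀ y : (AdelicGroupData.gl n K).Adelic,
      invQuot (AdelicGroupData.gl n K) Φ (y * sc) = ((ω z : ℂˣ) : ℂ) * invQuot (AdelicGroupData.gl n K) Φ y := fun y => by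
    rw [invQuot_mul_eq_smul Φ y, hpt, invQuot_apply]
  have hcomm : sc * gA = gA * sc :=
    ((Subgroup.mem_center_iff.1 (generalLinearGroup_scalar_mem_center (n := n) (K := K) z)) gA).symm
  change invQuot (AdelicGroupData.gl n K) Φ (sc * gA) = ((ω z : ℂˣ) : ℂ) * invQuot (AdelicGroupData.gl n K) Φ gA
  rw [hcomm]
  exact key gA

variable [MeasurableSpace ↥(adelicUnipotent n K)] [BorelSpace ↥(adelicUnipotent n K)]
  [MeasurableConstSMul ↥(rationalUnipotent n K) ↥(adelicUnipotent n K)]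
  {ν : Measure ↥(adelicUnipotent n K)} [IsFiniteMeasureOnCompacts ν]
  [SMulInvariantMeasure ↥(rationalUnipotent n K) ↥(adelicUnipotent n K) ν] [ν.IsMulRightInvariant]
  {𝓕 : Set ↥(adelicUnipotent n K)} {ψ : AddChar (AdeleRing (𝓞 K) K) Circle}

open scoped Classical in
/-- **Honest Hecke eigen cusp forms inside a cuspidal representation.** Let `Π ⊆ L²_cusp(GL_n(K) A_G \ GL_n(𝔸_K))`
be a cuspidal automorphic representation with Satake family `α` off `S`, `ψ` a global additive
character and `𝓕` a relatively compact fundamental domain of `N_n(K)` in `N_n(𝔸_K)`. There are a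
continuous `Φ ∈ ℒ²` with `[Φ] ∈ Π` whose classical function `φ = invQuot Φ` is a NON-ZERO HONEST CUSP
FORM, a level `𝔫₀ ≠ 0` with `φ` right `K(𝔫₀)`-invariant, and a unitary Hecke character `ω` (trivial on
`A_G`) with `φ((z 1_n) g) = ω(z) φ(g)`, such that at every `v ∉ S` with `v ∤ 𝔫₀` where `ψ_v` has conductor
`𝒪_v`, for every enumeration `x` of `α_v`, the global Whittaker coefficient `W_φ = whittakerCoeff ν 𝓕 ψ φ`
is an unramified Whittaker–Hecke datum at `v` with parameters `x` (`IsTorusUnramifiedAt`) for some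
uniformizer. (Borel–Jacquet (1979), §4.6: the `K`-finite vectors of an irreducible `Π ⊆ L²_cusp` are cusp
forms, on which the centre acts by `ω_Π` and the unramified Hecke algebra by the Satake parameters;
Shintani (1976) for the Whittaker function; Cogdell (2004), Thm. 3.3.) [cite: BorelJacquet1979, 4.6]
[cite: Shintani1976, Theorem (p. 181)] -/
theorem exists_isCuspFormGL_isTorusUnramifiedAt_whittakerCoeff (P : CuspidalAutomorphicRepGL n K μ)
    {S : Set (HeightOneSpectrum (𝓞 K))} {α : SatakeFamily K} (hα : IsSatakeFamilyOf P S α)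
    (h𝓕 : IsFundamentalDomain ↥(rationalUnipotent n K) 𝓕 ν) (h𝓕c : IsCompact (closure 𝓕))
    (hψ : IsGlobalAddChar K ψ) :
    ∃ (Φ : (AdelicGroupData.gl n K).automorphicQuotient → ℂ) (hΦ2 : MemLp Φ 2 μ) (𝔫₀ : Ideal (𝓞 K))
      (ω : Literature.NumberTheory.GaloisRepresentations.HeckeCharacter K),
      hΦ2.toLp Φ ∈ P.1 ∧ Continuous Φ ∧ invQuot (AdelicGroupData.gl n K) Φ ≠ 0 ∧
      IsCuspFormGL n K (isCompact_glFiniteIntegralLevel_holds n K) (invQuot (AdelicGroupData.gl n K) Φ) ∧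
      𝔫₀ ≠ 0 ∧
      (∀ k ∈ principalCongruenceLevel n K 𝔫₀, ∀ y : GL (Fin n) (AdeleRing (𝓞 K) K),
        invQuot (AdelicGroupData.gl n K) Φ (y * k) = invQuot (AdelicGroupData.gl n K) Φ y) ∧
      ω.IsUnitary ∧ (∀ t : NNRealˣ, ω (posRealIdele K t) = 1) ∧
      (∀ (z : Literature.NumberTheory.GaloisRepresentations.ideleGroup K) (g : GL (Fin n) (AdeleRing (𝓞 K) K)),
        invQuot (AdelicGroupData.gl n K) Φ (Matrix.GeneralLinearGroup.scalar (Fin n) z * g) =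
          ((ω z : ℂˣ) : ℂ) * invQuot (AdelicGroupData.gl n K) Φ g) ∧
      ∀ {v : HeightOneSpectrum (𝓞 K)}, v ∉ S → ¬ v.asIdeal ∣ 𝔫₀ →
        (∀ c ∈ 𝒪[v.adicCompletion K], ψ.adicComponent v c = 1) →
        (∀ ϖ : v.adicCompletion K, Valued.v ϖ = WithZero.exp (-1 : ℤ) →
          ∃ c ∈ 𝒪[v.adicCompletion K], ψ.adicComponent v (ϖ⁻¹ * c) ≠ 1) →
        ∀ {x : Fin n → ℂ}, (Finset.univ : Finset (Fin n)).val.map x = α v →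
          ∃ ϖ : (v.adicCompletion K)ˣ, IsTorusUnramifiedAt n K
            (whittakerCoeff ν 𝓕 ψ (invQuot (AdelicGroupData.gl n K) Φ)) v ϖ x := by
  obtain ⟨Φ, hΦ2, hP, hΦc, hΦ0, hcusp⟩ := exists_isCuspFormGL_invQuot_mem P
  obtain ⟨𝔫₀, h𝔫₀, hΦU⟩ := hcusp.exists_principalCongruenceLevel
  obtain ⟨ω, hu, hA, hω⟩ := exists_centralCharacter_invQuot P hΦc hΦ2 hP
  refine ⟨Φ, hΦ2, 𝔫₀, ω, hP, hΦc, hΦ0, hcusp, h𝔫₀, hΦU, hu, hA, hω, ?_⟩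
  intro v hvS hv hψv hψv' x hx
  set sv : P.1.toSubmodule := ⟨hΦ2.toLp Φ, ContRepresentation.ClosedSubrep.mem_toSubmodule.2 hP⟩ with hsv
  have hae : ((sv : (AdelicGroupData.gl n K).L2 μ) : (AdelicGroupData.gl n K).automorphicQuotient → ℂ) =ᵐ[μ] Φ :=
    hΦ2.coeFn_toLp
  exact exists_isTorusUnramifiedAt_whittakerCoeff_of_ae_eq P hα h𝔫₀ hvS hv hΦc sv hae hΦU hx h𝓕 h𝓕c hψ hψv hψv'

end Honest

end Literature.NumberTheory.Automorphic
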